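import Mathlib
import HarnessLib

/-! # Route MonotoneRestoration — crux `MonotoneRestorationQP`, line Sketch, stub D′2
(stmt-ValiantsHypothesis-15886)

**Permutations of a word from adjacent transpositions in context.** A function `c` of lists that
is unchanged by swapping two ADJACENT letters of any list of length `n` (with arbitrary prefix
and suffix) takes equal values on any two lists of length `n` that are permutations of each
other.

Proof: pure list combinatorics. We prove the contextual statement
`∀ p s, (p ++ l ++ s).length = n → c (p ++ l ++ s) = c (p ++ l' ++ s)` by induction on the
derivation of `l ~ l'` (`nil`, `cons`, `swap`, `trans`); the `swap` case is the hypothesis, the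
`cons` case moves the head letter into the prefix, and `trans` chains (permutations preserve
length). Instantiating with empty prefix and suffix gives the claim.
-/

-- `Summit.ValiantsHypothesis.ValiantsHypothesis.…` is the tree's mandated namespace (Sub = Summit).
set_option linter.dupNamespace false

namespace Summit.ValiantsHypothesis.ValiantsHypothesis.Theorems

/-- **D′2 — contextual form.** If `c` is unchanged by swapping two adjacent letters of any list of
length `n`, then for `l ~ l'` and any prefix `p` and suffix `s` with `(p ++ l ++ s).length = n`
we have `c (p ++ l ++ s) = c (p ++ l' ++ s)` (induction on the `List.Perm` derivation).
[folklore] -/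
theorem permOfSwap_context {α β : Type} (n : ℕ) (c : List α → β)
    (hswap : ∀ (p s : List α) (a b : α), (p ++ a :: b :: s).length = n →
      c (p ++ a :: b :: s) = c (p ++ b :: a :: s))
    {l l' : List α} (hl : l.Perm l') :
    ∀ p s : List α, (p ++ l ++ s).length = n → c (p ++ l ++ s) = c (p ++ l' ++ s) := by
  induction hl with
  | nil => intro p s _; rfl
  | cons x _ ih =>
      intro p s hlen
      have h := ih (p ++ [x]) s (by simpa using hlen)
      simpa using h
  | swap x y l =>
      intro p s hlen
      have h := hswap p (l ++ s) y x (by simpa using hlen)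
      simpa using h
  | trans h₁ _ ih₁ ih₂ =>
      intro p s hlen
      rw [ih₁ p s hlen]
      refine ih₂ p s ?_
      simp only [List.length_append] at hlen ⊢
      rw [← h₁.length_eq]
      exact hlen

/-- **D′2 — PERMUTATIONS OF A WORD FROM ADJACENT TRANSPOSITIONS IN CONTEXT** (crux
`MonotoneRestorationQP`, line Sketch; registered stub `stub_permOfSwap`). A function of lists
that is unchanged by swapping two ADJACENT letters of any list of length `n` (arbitrary prefix
and suffix) takes equal values on any two lists of length `n` that are permutations of each
other (the contextual lemma `permOfSwap_context` with empty prefix and suffix). [folklore] -/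
theorem stub_permOfSwap {α β : Type} (n : ℕ) (c : List α → β)
    (hswap : ∀ (p s : List α) (a b : α), (p ++ a :: b :: s).length = n →
      c (p ++ a :: b :: s) = c (p ++ b :: a :: s))
    (l l' : List α) (hl : l.Perm l') (hn : l.length = n) : c l = c l' := by
  simpa using permOfSwap_context n c hswap hl [] [] (by simpa using hn)

end Summit.ValiantsHypothesis.ValiantsHypothesis.Theorems
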